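import Summits.CriticalPhenomena.PercolationContinuityZ3.Theorems.Transplant.KNCellsBoxProdZ2ConcRoot
import Summits.CriticalPhenomena.PercolationContinuityZ3.Theorems.Transplant.KNCellsBoxProdZ2RootRun
import HarnessLib

/-!
# Design (D), (R): the root residue `RootOblA` of the concentric scheme FROM THE PLANAR ROOT RUN — `rootOblA_concG` (KNCellsBoxProdZ2ConcRoot)
# with the straight-run data `rootTAD` built on `rootCtr / rootρ` (KNCellsBoxProdZ2RootRun): admissibility, the rim parts inside the regions
# and the three planar facts are discharged; what remains per direction is `RootRunOK`, three radius facts, the level-window numerics, and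
# p3-g2's kit clauses / rim excess / first hop and the lead's count

builds on p205010 (kernel theorem, internal audit signed; external expert review pending) — nothing in this file uses p205010.
Lane `prim-bschramm`, seat `prim-bschramm-p2` ((R) = p2); helper file (`--supports stmt-CriticalPhenomena-4575`).

* `rootTAD X w₀ Rt L' du t R' ℓ₀ ca cb q' Rlev N j₀ j₁ Sfin : TubeAdvData W` — window `B_X(w₀, Rt)`, `q = 0`, `s₁ = t`, `ρ = rootρ t R' q'`,
  `nA = 44`, axis `du.1`, sign `sgOf du`, centre `rootCtr du ca cb`, root `(w₀, 0)`, rim parts `(B(w₀,Rt) \ B(w₀,Rt - L')) × region_k`;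
* **`rootOblA_of_rootRun`**.
[cite: KozmaNitzan2024, §4 p. 28 ((32) at the root), Lemma 11 (pp. 22–23)]
-/

noncomputable section

open MeasureTheory ProbabilityTheory
open scoped ENNReal Classical

namespace Summit.CriticalPhenomena.PercolationContinuityZ3.Theorems

namespace Transplant

namespace BoxProdZ2

open Literature.Probability.Percolation Literature.Probability.LatticeModels SimpleGraph GadgetSystem ProbeHistory HSiteScheme Contour KNCells
open Literature.Probability.Percolation.KozmaNitzan.Cells (sgOf sgOf_sign)

variable {W : Type} [DecidableEq W] (X : SimpleGraph W) [X.LocallyFinite]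

/-- **The straight-run tube data of the root probe** in direction `du` over the window `B_X(w₀, Rt)`. [cite: KozmaNitzan2024, §4 p. 28, Lemma 11] -/
def rootTAD (w₀ : W) (Rt L' : ℕ) (du : MDir) (t R' ℓ₀ : ℕ) (ca cb q' : ℤ) (Rlev N j₀ j₁ : ℕ) (Sfin : Finset (W × Site 2)) :
    TubeAdvData W where
  π := ballFin X w₀ Rt
  q := 0
  q' := q'
  s₁ := t
  ρ := rootρ t R' q'
  R' := R'
  ℓ₀ := ℓ₀
  nA := 44
  ax := du.1
  sg := sgOf du
  c := rootCtr du ca cb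
  Rlev := Rlev
  N := N
  j₀ := j₀
  j₁ := j₁
  root := (w₀, 0)
  Sfin := Sfin
  Rim := fun k => (ballFin X w₀ Rt \ ballFin X w₀ (Rt - L')) ×ˢ ChainPlanar.Adv.region 0 (t : ℤ) (rootρ t R' q') du.1 (sgOf du) (rootCtr du ca cb) k

/-- **THE ROOT RESIDUE FROM THE PLANAR ROOT RUN.** [cite: KozmaNitzan2024, §4 p. 28 ((32) at the root), Lemma 11 (pp. 22–23)] -/
theorem rootOblA_of_rootRun (C : PCells) (w₀ : W) (Λ : ConcRadiiG) (q : unitInterval) (δc : ℝ) {Δ' : ℕ} {δr : ℕ → ℝ}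
    {Rt L' t R' ℓ₀ Rlev N j₀ j₁ : ℕ} {ca cb q' : MDir → ℤ} (hOK : ∀ du, RootRunOK C t R' ℓ₀ (ca du) (cb du) (q' du))
    (hRl : Rlev + 1 ≤ R') (hj : j₁ ≤ Rlev)
    (P : MDir → TubeAdvData W)
    (hP : ∀ du, P du = rootTAD X w₀ Rt L' du t R' ℓ₀ (ca du) (cb du) (q' du) Rlev N j₀ j₁
      (((concSchemeG X C w₀ Λ q δc).U0root du).filter fun y => y.1 ∈ ballFin X w₀ Rt))
    -- three radius facts
    (hRB : ∀ du, Rt ≤ Λ.rB 0 0 du) (hRQ : ∀ du, Rt ≤ Λ.rQ 0 ((0 : Site 2) + stepVec du))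
    (hRM : ∀ du, Rt ≤ Λ.rM 0 ((0 : Site 2) + stepVec du))
    -- the analytic inputs (p3-g2 / lead)
    (hcount : ∀ du, 1 / (1 - (q : ℝ)) ^ (Δ' * (P du).N) ≤ δr (P du).nA * ((Finset.Icc (P du).j₀ (P du).j₁).card : ℝ))
    (hkits : ∀ du, ∀ k ≤ (P du).nA, ∀ j ∈ Finset.Icc (P du).j₀ (P du).j₁,
      ∃ (σ : KNLevels.SData (W × Site 2)) (Sz : Finset (W × Site 2)),
      KNLevels.SHyp (tubeLData X (P du).π ((P du).alo k) ((P du).ahi k) (P du).root (P du).Sfin) j σ ∧ σ.N ≤ (P du).N ∧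
      (1 - (q : ℝ) ^ σ.sB) ^ σ.k ≤ δr (P du).nA ∧ Sz ⊆ (tubeLData X (P du).π ((P du).alo k) ((P du).ahi k) (P du).root (P du).Sfin).X j ∧
      Sz ⊆ (P du).stepD k ∧
      (∀ x ∈ σ.K, ∀ e' ∈ σ.seed x, e' ∉ wireSet (↑Sz : Set (W × Site 2))) ∧ (∀ x ∈ σ.K, σ.face x ⊆ Sz) ∧
      (∀ x ∈ σ.K, 1 - 3 * δr (P du).nA ≤ (prodBernoulli ((concSchemeG X C w₀ Λ q δc).W0sub (X □ zdGraph 2)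
          (((concSchemeG X C w₀ Λ q δc).U0root du).filter fun y => y.1 ∈ ballFin X w₀ Rt))).real {ω | ∃ u ∈ σ.face x,
        1 - δr (P du).nA < (prodBernoulli (pinW ((concSchemeG X C w₀ Λ q δc).W0sub (X □ zdGraph 2)
          (((concSchemeG X C w₀ Λ q δc).U0root du).filter fun y => y.1 ∈ ballFin X w₀ Rt))
          (wireSet (↑Sz : Set (W × Site 2))) ω)).real
          (⋃ t ∈ (P du).coreE k, openConnIn (↑((P du).stepD k) : Set (W × Site 2)) u t)}))
    {η : ℝ} (hη : ∀ du, η ≤ δr (P du).nA / 2)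
    (hexc : ∀ du, ∀ k ≤ (P du).nA, (prodBernoulli ((concSchemeG X C w₀ Λ q δc).W0sub (X □ zdGraph 2)
        (((concSchemeG X C w₀ Λ q δc).U0root du).filter fun y => y.1 ∈ ballFin X w₀ Rt))).real
        (⋃ t ∈ (P du).Rim k, openConn ((w₀, (0 : Site 2)) : W × Site 2) t) ≤ η)
    {π₀ : MDir → Finset W} {Bpl : MDir → Finset (Site 2)}
    (hπ₀ : ∀ du, π₀ du ⊆ ballFin X w₀ Rt) (hBpl : ∀ du, Bpl du ⊆ (P du).acore 0)
    (hsrc : ∀ du, 1 - δr (P du).nA < (prodBernoulli ((concSchemeG X C w₀ Λ q δc).W0sub (X □ zdGraph 2)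
        (((concSchemeG X C w₀ Λ q δc).U0root du).filter fun y => y.1 ∈ ballFin X w₀ Rt))).real
        (⋃ t ∈ π₀ du ×ˢ Bpl du, openConn ((w₀, (0 : Site 2)) : W × Site 2) t)) :
    KSchA.RootOblA X (concSchemeG X C w₀ Λ q δc) Δ' δr := by
  refine rootOblA_concG X C w₀ Λ q δc P (fun _ => Rt) (fun du => π₀ du ×ˢ Bpl du) (fun _ => η)
    (fun du => by rw [hP]; rfl) (fun du => by rw [hP]; rfl) (fun du => by rw [hP]; rfl) (fun du => by rw [hP]; exact sgOf_sign du)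
    (fun du => by rw [hP]; exact rootRun_advOK (hOK du)) (fun du => by rw [hP]; exact hRl) (fun du k => ?_) (fun du => by rw [hP]; exact hj)
    hRB hRQ hRM (fun du k hk => ?_) (fun du k hk => ?_) (fun du => ?_) hcount hkits hη hexc (fun _ => rfl) hπ₀ hBpl hsrc
  · -- the rim parts lie in the regions
    rw [hP]
    exact Finset.product_subset_product_left (Finset.sdiff_subset)
  · -- regions inside `C.Btw 0 du ∪ C.Q (0 + du)`
    rw [hP] at hk ⊢
    exact rootRun_region_subset (hOK du) hk
  · -- regions off the wired root cube
    rw [hP] at hk ⊢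
    exact rootRun_region_disjoint_Q (hOK du) hk
  · -- the far face
    rw [hP]
    exact rootRun_last_subset_M (hOK du)

end BoxProdZ2

end Transplant

end Summit.CriticalPhenomena.PercolationContinuityZ3.Theorems

end
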